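import Literature.NumberTheory.Irrationality.Hata1992.PrimeWindows
import Literature.Analysis.SpecialFunctions.DigammaGauss
import HarnessLib

/-!
# Primes with `{n/p}` in an interval: `(1/n) Σ_{⌊n/p⌋ ≥ k₀, {n/p} ∈ [u,v)} log p → Σ_{k ≥ k₀} (1/(k+u) − 1/(k+v))`
# `= ψ(k₀+v) − ψ(k₀+u)` (the `dψ` form of the Chudnovsky–Rukhadze–Hata arithmetic scheme)

Topic `Literature/NumberTheory/Irrationality/Hata1992`. HONEST FRAMING (cell `pub-zeta5`): systematic search; no
irrationality claim unless certified. Nothing here concerns the arithmetic nature of any constant.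

The savings factors of the arithmetic method are products `Φ_n = ∏ p^{φ(n/p)}` over primes, `φ` a `1`-periodic step
function; their size is "`lim (log Φ_n)/n = ∫₀¹ φ(x) dψ(x) − …`, where `ψ(x)` is the logarithmic derivative of the gamma
function" [cite: Zudilin2004, Lemma 11 (5.8)], which "follows from the arithmetic scheme of Chudnovsky–Rukhadze–Hata"
(loc. cit., citing Hata 1990 Lemma 3.2), i.e. from the prime number theorem applied window by window:
`lim inf (1/n) Σ_{p ∈ (n/βλ, n/αλ)} log p ≥ (1/λ)(1/α − 1/β)`, summed over the windows to give `∫ dy/y²`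
[cite: Hata1992, §2, proof of (2.5), pp. 340–341].

`PrimeWindows.lean` proves the single-window statement. This file proves the INFINITE-window statement for one
interval of fractional parts, with the tail controlled by Chebyshev's bound `ϑ(x) ≤ x log 4`:

* `fracWindow u v k n = ∏ p` over the primes with `n/(k+v) < p ≤ n/(k+u)`, i.e. `⌊n/p⌋ = k` and `{n/p} ∈ [u,v)`
  (`0 < u < v ≤ 1`); `fracProd u v k₀ n = ∏_{k₀ ≤ k ≤ n} fracWindow u v k n` (for `k > n` the windows are empty);
* `log_fracProd_le_head_add_tail` — for `K ≥ k₀`: `log fracProd ≤ Σ_{k₀ ≤ k ≤ K} log fracWindow + ϑ(n/(K+1))` and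
  `theta_div_le` — `ϑ(n/(K+1)) ≤ log 4 · n/(K+1)`;
* **`tendsto_log_fracProd_div`** — `(log fracProd u v k₀ n)/n → Σ_{k ≥ 0} (1/(k+k₀+u) − 1/(k+k₀+v))`;
* `hasSum_one_div_add_sub_one_div_add` — `Σ_{k ≥ 0} (1/(u+k) − 1/(v+k)) = Re(ψ(v) − ψ(u))` for real `u, v > 0`
  (from the tree's `Literature.Analysis.SpecialFunctions.Complex.hasSum_one_div_sub_one_div_digamma`, Mathlib's
  `Complex.digamma`), whence **`tendsto_log_fracProd_div_digamma`**: the limit is `Re(ψ(k₀+v) − ψ(k₀+u))`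
  `= ∫_{[u,v)+k₀+ℕ} dψ`;
* `eventually_exp_le_fracProd` — the `le_saving` shape `e^{(S−ε)n} ≤ fracProd` for large `n`.

A general `1`-periodic step function `φ = Σ_i c_i·1_{[u_i,v_i)}` with `c_i ∈ ℕ` is the finite product of these
(`-- TODO(general form):` the bookkeeping for arbitrary step functions and the lower cut-off `p > √(Cn)`, which
removes `O(√n log n)` and does not change the limit, are left to the user).

## References
* [Hata1992] M. Hata, Acta Arith. 60 (1992) 335–347, §2 (proof of (2.5), pp. 340–341).
* [Zudilin2004] W. Zudilin, J. Théor. Nombres Bordeaux 16 (2004) 251–291, Lemma 11, §8 p. 270–271.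
* [AndrewsAskeyRoy1999] Thm 1.2.5 (1.2.13) (the digamma series; tree file `DigammaGauss.lean`).
-/

noncomputable section

open Finset Filter Real
open scoped Topology

namespace Literature.NumberTheory.Irrationality.Hata1992

variable {u v : ℝ}

/-! ### One fractional-part window `⌊n/p⌋ = k`, `{n/p} ∈ [u,v)` -/

/-- The product of the primes `p` with `n/(k+v) < p ≤ n/(k+u)`, i.e. (for `0 < u < v ≤ 1`) `⌊n/p⌋ = k` and
`u ≤ {n/p} < v`. [cite: Hata1992, §2 p. 340 (the interval `J_L = (n/βλ, n/αλ)`); Zudilin2004, §8 p. 271] -/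
def fracWindow (u v : ℝ) (k n : ℕ) : ℕ := windowProd (1 / ((k : ℝ) + v)) (1 / ((k : ℝ) + u)) n

/-- The product over all windows `k₀ ≤ k ≤ n` (windows with `k > n` contain no prime): all primes `p ≤ n/(k₀+u)`
with `{n/p} ∈ [u,v)`. [cite: Zudilin2004, §8 (8.8) and Lemma 11] -/
def fracProd (u v : ℝ) (k₀ n : ℕ) : ℕ := ∏ k ∈ Ico k₀ (n + 1), fracWindow u v k n

/-- Positivity of a window factor. [cite: Hata1992, §2 p. 340] -/
theorem fracWindow_pos (u v : ℝ) (k n : ℕ) : 0 < fracWindow u v k n := windowProd_pos _ _ _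

/-- Positivity of the full factor. [cite: Zudilin2004, §8 (8.8)] -/
theorem fracProd_pos (u v : ℝ) (k₀ n : ℕ) : 0 < fracProd u v k₀ n :=
  prod_pos fun k _ => fracWindow_pos u v k n

/-- `log fracWindow = ϑ(n/(k+u)) − ϑ(n/(k+v))` (`0 < u ≤ v`). [cite: Hata1992, §2 pp. 340–341] -/
theorem log_fracWindow (hu : 0 < u) (huv : u ≤ v) (k n : ℕ) :
    Real.log (fracWindow u v k n : ℕ) =
      Chebyshev.theta ((n : ℝ) / ((k : ℝ) + u)) - Chebyshev.theta ((n : ℝ) / ((k : ℝ) + v)) := by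
  have hku : 0 < (k : ℝ) + u := by positivity
  have hkv : 0 < (k : ℝ) + v := by linarith
  have hab : 1 / ((k : ℝ) + v) ≤ 1 / ((k : ℝ) + u) := one_div_le_one_div_of_le hku (by linarith)
  unfold fracWindow
  rw [log_windowProd_eq_theta_sub hab n, one_div_mul_eq_div, one_div_mul_eq_div]

/-- `0 ≤ log fracWindow`. [cite: Hata1992, §2 p. 340] -/
theorem log_fracWindow_nonneg (u v : ℝ) (k n : ℕ) : 0 ≤ Real.log (fracWindow u v k n : ℕ) :=
  Real.log_nonneg (by exact_mod_cast fracWindow_pos u v k n)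

/-- The telescoping majorant: for `v ≤ 1`, `log fracWindow u v k n ≤ ϑ(n/(k+u)) − ϑ(n/(k+1+u))`.
[cite: Hata1992, §2 p. 341 ("a similar argument" for the upper estimate)] -/
theorem log_fracWindow_le (hu : 0 < u) (huv : u ≤ v) (hv : v ≤ 1) (k n : ℕ) :
    Real.log (fracWindow u v k n : ℕ) ≤
      Chebyshev.theta ((n : ℝ) / ((k : ℝ) + u)) - Chebyshev.theta ((n : ℝ) / (((k + 1 : ℕ) : ℝ) + u)) := by
  rw [log_fracWindow hu huv]
  have hkv : 0 < (k : ℝ) + v := by have : 0 ≤ (k : ℝ) := Nat.cast_nonneg k; linarith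
  have h : (n : ℝ) / (((k + 1 : ℕ) : ℝ) + u) ≤ (n : ℝ) / ((k : ℝ) + v) := by
    apply div_le_div_of_nonneg_left (Nat.cast_nonneg n) hkv
    push_cast; linarith
  linarith [Chebyshev.theta_mono h]

/-! ### Head and tail -/

/-- `log fracProd = Σ_{k₀ ≤ k ≤ n} log fracWindow`. [cite: Zudilin2004, §8 p. 271] -/
theorem log_fracProd (u v : ℝ) (k₀ n : ℕ) :
    Real.log (fracProd u v k₀ n : ℕ) = ∑ k ∈ Ico k₀ (n + 1), Real.log (fracWindow u v k n : ℕ) := by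
  unfold fracProd
  rw [Nat.cast_prod, Real.log_prod]
  intro k _
  exact_mod_cast (fracWindow_pos u v k n).ne'

/-- Telescoping over an interval of indices. [folklore] -/
private theorem sum_Ico_telescope (f : ℕ → ℝ) {a b : ℕ} (hab : a ≤ b) :
    ∑ k ∈ Ico a b, (f k - f (k + 1)) = f a - f b := by
  induction b, hab using Nat.le_induction with
  | base => simp
  | succ b hab ih => rw [sum_Ico_succ_top hab, ih]; ring

/-- The tail over the windows `K+1 ≤ k ≤ n` is at most `ϑ(n/(K+1+u))` (telescoping).
[cite: Hata1992, §2 p. 341] -/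
theorem sum_log_fracWindow_tail_le (hu : 0 < u) (huv : u ≤ v) (hv : v ≤ 1) (K n : ℕ) :
    ∑ k ∈ Ico (K + 1) (n + 1), Real.log (fracWindow u v k n : ℕ) ≤
      Chebyshev.theta ((n : ℝ) / (((K + 1 : ℕ) : ℝ) + u)) := by
  rcases le_or_gt (K + 1) (n + 1) with hKn | hKn
  · set f : ℕ → ℝ := fun k => Chebyshev.theta ((n : ℝ) / ((k : ℝ) + u)) with hf
    calc ∑ k ∈ Ico (K + 1) (n + 1), Real.log (fracWindow u v k n : ℕ)
          ≤ ∑ k ∈ Ico (K + 1) (n + 1), (f k - f (k + 1)) :=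
            sum_le_sum fun k _ => log_fracWindow_le hu huv hv k n
        _ = f (K + 1) - f (n + 1) := sum_Ico_telescope f hKn
        _ ≤ f (K + 1) := by linarith [Chebyshev.theta_nonneg ((n : ℝ) / (((n + 1 : ℕ) : ℝ) + u))]
  · rw [Finset.Ico_eq_empty (by omega), sum_empty]
    exact Chebyshev.theta_nonneg _

/-- Chebyshev's bound on the tail: `ϑ(n/(K+1+u)) ≤ log 4 · n/(K+1)`. [cite: Hata1992, §2 p. 341] -/
theorem theta_tail_le (hu : 0 < u) (K n : ℕ) :
    Chebyshev.theta ((n : ℝ) / (((K + 1 : ℕ) : ℝ) + u)) ≤ Real.log 4 * ((n : ℝ) / ((K : ℝ) + 1)) := by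
  have hK : 0 < (K : ℝ) + 1 := by positivity
  have h1 : (n : ℝ) / (((K + 1 : ℕ) : ℝ) + u) ≤ (n : ℝ) / ((K : ℝ) + 1) := by
    apply div_le_div_of_nonneg_left (Nat.cast_nonneg n) hK
    push_cast; linarith
  calc Chebyshev.theta ((n : ℝ) / (((K + 1 : ℕ) : ℝ) + u))
      ≤ Chebyshev.theta ((n : ℝ) / ((K : ℝ) + 1)) := Chebyshev.theta_mono h1
    _ ≤ Real.log 4 * ((n : ℝ) / ((K : ℝ) + 1)) := Chebyshev.theta_le_log4_mul_x (by positivity)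

/-- Head/tail decomposition: for `k₀ ≤ K + 1 ≤ n + 1`,
`log fracProd = Σ_{k₀ ≤ k ≤ K} log fracWindow + Σ_{K < k ≤ n} log fracWindow`. [cite: Zudilin2004, §8 p. 271] -/
theorem log_fracProd_eq_head_add_tail (u v : ℝ) {k₀ K n : ℕ} (hk : k₀ ≤ K + 1) (hKn : K + 1 ≤ n + 1) :
    Real.log (fracProd u v k₀ n : ℕ) =
      ∑ k ∈ Ico k₀ (K + 1), Real.log (fracWindow u v k n : ℕ)
        + ∑ k ∈ Ico (K + 1) (n + 1), Real.log (fracWindow u v k n : ℕ) := by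
  rw [log_fracProd, ← sum_Ico_consecutive _ hk hKn]

/-- The head term: `(1/n) Σ_{k₀ ≤ k ≤ K} log fracWindow → Σ_{k₀ ≤ k ≤ K} (1/(k+u) − 1/(k+v))`.
[cite: Hata1992, §2, proof of (2.5), pp. 340–341] -/
theorem tendsto_head_div (hu : 0 < u) (huv : u ≤ v) (k₀ K : ℕ) :
    Tendsto (fun n : ℕ => (∑ k ∈ Ico k₀ (K + 1), Real.log (fracWindow u v k n : ℕ)) / n) atTop
      (𝓝 (∑ k ∈ Ico k₀ (K + 1), (1 / ((k : ℝ) + u) - 1 / ((k : ℝ) + v)))) := by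
  have hk : ∀ k ∈ Ico k₀ (K + 1), Tendsto (fun n : ℕ => Real.log (fracWindow u v k n : ℕ) / n) atTop
      (𝓝 (1 / ((k : ℝ) + u) - 1 / ((k : ℝ) + v))) := by
    intro k _
    have hku : 0 < (k : ℝ) + u := by positivity
    have hkv : 0 < (k : ℝ) + v := by linarith
    have ha : 0 ≤ 1 / ((k : ℝ) + v) := by positivity
    have hab : 1 / ((k : ℝ) + v) ≤ 1 / ((k : ℝ) + u) := one_div_le_one_div_of_le hku (by linarith)
    exact tendsto_log_windowProd_div ha hab
  refine (tendsto_finsetSum _ hk).congr' (Eventually.of_forall fun n => ?_)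
  beta_reduce
  rw [sum_div]

/-! ### The series `Σ (1/(k+u) − 1/(k+v))` and the digamma function -/

/-- For real `u, v > 0`: `Σ_{k ≥ 0} (1/(u+k) − 1/(v+k)) = Re(ψ(v) − ψ(u))` (`ψ = Γ'/Γ`, Mathlib's `Complex.digamma`;
for real arguments the value is real). [cite: AndrewsAskeyRoy1999, Thm 1.2.5 (1.2.13); Zudilin2004, Lemma 11] -/
theorem hasSum_one_div_add_sub_one_div_add (hu : 0 < u) (hv : 0 < v) :
    HasSum (fun k : ℕ => 1 / (u + k) - 1 / (v + k)) (Complex.digamma v - Complex.digamma u).re := by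
  have h1 := Literature.Analysis.SpecialFunctions.Complex.hasSum_one_div_sub_one_div_digamma
    (w := (u : ℂ)) (by simpa using hu)
  have h2 := Literature.Analysis.SpecialFunctions.Complex.hasSum_one_div_sub_one_div_digamma
    (w := (v : ℂ)) (by simpa using hv)
  have h := h2.sub h1
  have hfun : ∀ k : ℕ, ((1 : ℂ) / ((k : ℂ) + 1) - 1 / ((v : ℂ) + k)) - (1 / ((k : ℂ) + 1) - 1 / ((u : ℂ) + k))
      = ((1 / (u + k) - 1 / (v + k) : ℝ) : ℂ) := by
    intro k; push_cast; ring
  have hval : (Complex.digamma v + Real.eulerMascheroniConstant) - (Complex.digamma u + Real.eulerMascheroniConstant)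
      = Complex.digamma v - Complex.digamma u := by ring
  rw [hval] at h
  simp_rw [hfun] at h
  have hre := ((Complex.hasSum_iff _ _).mp h).1
  simpa only [Complex.ofReal_re] using hre

/-- The terms `1/(k+u) − 1/(k+v)` are summable (`u, v > 0`). [cite: AndrewsAskeyRoy1999, Thm 1.2.5 (1.2.13)] -/
theorem summable_fracTerm (hu : 0 < u) (hv : 0 < v) :
    Summable (fun k : ℕ => 1 / ((k : ℝ) + u) - 1 / ((k : ℝ) + v)) := by
  refine (hasSum_one_div_add_sub_one_div_add hu hv).summable.congr fun k => ?_
  rw [add_comm u, add_comm v]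

/-- The terms are nonnegative for `u ≤ v`. [cite: Zudilin2004, Lemma 11] -/
theorem fracTerm_nonneg (hu : 0 < u) (huv : u ≤ v) (k : ℕ) :
    0 ≤ 1 / ((k : ℝ) + u) - 1 / ((k : ℝ) + v) :=
  sub_nonneg.2 (one_div_le_one_div_of_le (by positivity) (by linarith))

/-- The limit rate `S(u,v,k₀) = Σ_{k ≥ 0} (1/(k+k₀+u) − 1/(k+k₀+v))` (`= ∫ dψ` over `[u,v) + k₀ + ℕ`, see
`fracRate_eq_digamma`). [cite: Zudilin2004, Lemma 11 (5.8)] -/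
def fracRate (u v : ℝ) (k₀ : ℕ) : ℝ :=
  ∑' k : ℕ, (1 / (((k + k₀ : ℕ) : ℝ) + u) - 1 / (((k + k₀ : ℕ) : ℝ) + v))

/-- The defining series of `fracRate` converges to it. [cite: Zudilin2004, Lemma 11] -/
theorem hasSum_fracRate (hu : 0 < u) (hv : 0 < v) (k₀ : ℕ) :
    HasSum (fun k : ℕ => 1 / (((k + k₀ : ℕ) : ℝ) + u) - 1 / (((k + k₀ : ℕ) : ℝ) + v)) (fracRate u v k₀) := by
  have h : Summable (fun k : ℕ => 1 / (((k + k₀ : ℕ) : ℝ) + u) - 1 / (((k + k₀ : ℕ) : ℝ) + v)) :=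
    (summable_nat_add_iff (f := fun k : ℕ => 1 / ((k : ℝ) + u) - 1 / ((k : ℝ) + v)) k₀).2
      (summable_fracTerm hu hv)
  exact h.hasSum

/-- `fracRate` in closed form: `S(u,v,k₀) = Re(ψ(k₀+v) − ψ(k₀+u))` (real for real arguments).
[cite: Zudilin2004, Lemma 11 (5.8) ("`ψ(x)` is the logarithmic derivative of the gamma function")] -/
theorem fracRate_eq_digamma (hu : 0 < u) (hv : 0 < v) (k₀ : ℕ) :
    fracRate u v k₀ = (Complex.digamma ((k₀ : ℝ) + v : ℝ) - Complex.digamma ((k₀ : ℝ) + u : ℝ)).re := by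
  have h := hasSum_one_div_add_sub_one_div_add (u := (k₀ : ℝ) + u) (v := (k₀ : ℝ) + v)
    (by positivity) (by positivity)
  refine (hasSum_fracRate hu hv k₀).unique (h.congr_fun fun k => ?_) ▸ rfl
  push_cast; ring

/-- **The fractional-part window theorem** (`0 < u < v ≤ 1`):
`(1/n) log ∏_{⌊n/p⌋ ≥ k₀, {n/p} ∈ [u,v)} p → Σ_{k ≥ k₀} (1/(k+u) − 1/(k+v))` — the prime number theorem on each
window `n/(k+v) < p ≤ n/(k+u)` plus Chebyshev's bound `ϑ(x) ≤ x log 4` on the union of the windows `k > K`.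
[cite: Hata1992, §2, proof of (2.5), pp. 340–341; Zudilin2004, Lemma 11] -/
theorem tendsto_log_fracProd_div (hu : 0 < u) (huv : u < v) (hv : v ≤ 1) (k₀ : ℕ) :
    Tendsto (fun n : ℕ => Real.log (fracProd u v k₀ n : ℕ) / n) atTop (𝓝 (fracRate u v k₀)) := by
  set g : ℕ → ℝ := fun k => 1 / ((k : ℝ) + u) - 1 / ((k : ℝ) + v) with hg
  have hg0 : ∀ k, 0 ≤ g k := fracTerm_nonneg hu huv.le
  have hS : HasSum (fun k : ℕ => g (k + k₀)) (fracRate u v k₀) := hasSum_fracRate hu (hu.trans huv) k₀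
  have hP : Tendsto (fun m : ℕ => ∑ i ∈ range m, g (i + k₀)) atTop (𝓝 (fracRate u v k₀)) :=
    hS.tendsto_sum_nat
  -- the head sums in terms of partial sums, and `S_K ≤ S`
  have hSK : ∀ K, ∑ k ∈ Ico k₀ (K + 1), g k = ∑ i ∈ range (K + 1 - k₀), g (i + k₀) := by
    intro K; rw [sum_Ico_eq_sum_range]; exact sum_congr rfl fun i _ => by rw [add_comm]
  have hSK_le : ∀ K, ∑ k ∈ Ico k₀ (K + 1), g k ≤ fracRate u v k₀ := by
    intro K; rw [hSK]
    exact sum_le_hasSum _ (fun i _ => hg0 _) hS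
  -- head/tail bounds, eventually in `n`
  have hbounds : ∀ K : ℕ, k₀ ≤ K + 1 → ∀ᶠ n : ℕ in atTop,
      (∑ k ∈ Ico k₀ (K + 1), Real.log (fracWindow u v k n : ℕ)) / n
          ≤ Real.log (fracProd u v k₀ n : ℕ) / n ∧
      Real.log (fracProd u v k₀ n : ℕ) / n
          ≤ (∑ k ∈ Ico k₀ (K + 1), Real.log (fracWindow u v k n : ℕ)) / n + Real.log 4 / ((K : ℝ) + 1) := by
    intro K hK
    filter_upwards [eventually_ge_atTop (K + 1)] with n hn
    have hn0 : (0 : ℝ) < n := by exact_mod_cast (show 0 < n by omega)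
    have hdec := log_fracProd_eq_head_add_tail u v hK (show K + 1 ≤ n + 1 by omega)
    have htail0 : 0 ≤ ∑ k ∈ Ico (K + 1) (n + 1), Real.log (fracWindow u v k n : ℕ) :=
      sum_nonneg fun k _ => log_fracWindow_nonneg u v k n
    have htail1 := (sum_log_fracWindow_tail_le hu huv.le hv K n).trans (theta_tail_le hu K n)
    rw [hdec, add_div]
    constructor
    · linarith [div_nonneg htail0 hn0.le]
    · have : (∑ k ∈ Ico (K + 1) (n + 1), Real.log (fracWindow u v k n : ℕ)) / n
          ≤ Real.log 4 / ((K : ℝ) + 1) := by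
        rw [div_le_iff₀ hn0]
        calc ∑ k ∈ Ico (K + 1) (n + 1), Real.log (fracWindow u v k n : ℕ)
            ≤ Real.log 4 * ((n : ℝ) / ((K : ℝ) + 1)) := htail1
          _ = Real.log 4 / ((K : ℝ) + 1) * n := by ring
      linarith
  have hhead : ∀ K, Tendsto (fun n : ℕ => (∑ k ∈ Ico k₀ (K + 1), Real.log (fracWindow u v k n : ℕ)) / n)
      atTop (𝓝 (∑ k ∈ Ico k₀ (K + 1), g k)) := fun K => tendsto_head_div hu huv.le k₀ K
  rw [tendsto_order]
  constructor
  · -- lower: for `a < S` pick `m` with `P m > a`, `K + 1 = m + k₀`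
    intro a ha
    obtain ⟨m, hm⟩ := (hP.eventually (eventually_gt_nhds ha)).exists
    set K := m + k₀ with hK
    have hK1 : k₀ ≤ K + 1 := by omega
    have hhead' : ∀ᶠ n : ℕ in atTop,
        a < (∑ k ∈ Ico k₀ (K + 1), Real.log (fracWindow u v k n : ℕ)) / n := by
      refine (hhead K).eventually (eventually_gt_nhds ?_)
      rw [hSK, show K + 1 - k₀ = m + 1 by omega, sum_range_succ]
      linarith [hg0 (m + k₀)]
    filter_upwards [hhead', hbounds K hK1] with n h1 h2
    exact lt_of_lt_of_le h1 h2.1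
  · -- upper: for `a > S` pick `K` with `log 4/(K+1) < (a − S)/2`
    intro a ha
    set ε : ℝ := (a - fracRate u v k₀) / 2 with hε
    have hε0 : 0 < ε := by rw [hε]; linarith
    set K : ℕ := max k₀ ⌈Real.log 4 / ε⌉₊ with hK
    have hK1 : k₀ ≤ K + 1 := by omega
    have hKpos : (0 : ℝ) < (K : ℝ) + 1 := by positivity
    have htail : Real.log 4 / ((K : ℝ) + 1) < ε := by
      rw [div_lt_iff₀ hKpos]
      have h1 : Real.log 4 / ε ≤ ⌈Real.log 4 / ε⌉₊ := Nat.le_ceil _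
      have h2 : (⌈Real.log 4 / ε⌉₊ : ℝ) ≤ K := by exact_mod_cast le_max_right _ _
      have h3 : Real.log 4 / ε < (K : ℝ) + 1 := by linarith
      rw [div_lt_iff₀ hε0] at h3
      linarith
    have hhead' : ∀ᶠ n : ℕ in atTop,
        (∑ k ∈ Ico k₀ (K + 1), Real.log (fracWindow u v k n : ℕ)) / n < fracRate u v k₀ + ε :=
      (hhead K).eventually (eventually_lt_nhds (by linarith [hSK_le K]))
    filter_upwards [hhead', hbounds K hK1] with n h1 h2
    have : Real.log (fracProd u v k₀ n : ℕ) / n < fracRate u v k₀ + ε + ε := by linarith [h2.2]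
    have h2e : fracRate u v k₀ + ε + ε = a := by rw [hε]; ring
    linarith

/-- The same limit with the digamma value: `(1/n) log fracProd → Re(ψ(k₀+v) − ψ(k₀+u))`.
[cite: Zudilin2004, Lemma 11 (5.8); Hata1992, §2 pp. 340–341] -/
theorem tendsto_log_fracProd_div_digamma (hu : 0 < u) (huv : u < v) (hv : v ≤ 1) (k₀ : ℕ) :
    Tendsto (fun n : ℕ => Real.log (fracProd u v k₀ n : ℕ) / n) atTop
      (𝓝 ((Complex.digamma ((k₀ : ℝ) + v : ℝ) - Complex.digamma ((k₀ : ℝ) + u : ℝ)).re)) := by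
  rw [← fracRate_eq_digamma hu (hu.trans huv) k₀]
  exact tendsto_log_fracProd_div hu huv hv k₀

/-- The `le_saving` shape: for every `ε > 0`, `e^{(S − ε) n} ≤ fracProd u v k₀ n` for all large `n`.
[cite: Hata1992, §2, proof of (2.5); Zudilin2004, Lemma 11] -/
theorem eventually_exp_le_fracProd (hu : 0 < u) (huv : u < v) (hv : v ≤ 1) (k₀ : ℕ) {ε : ℝ} (hε : 0 < ε) :
    ∀ᶠ n : ℕ in atTop, Real.exp ((fracRate u v k₀ - ε) * n) ≤ (fracProd u v k₀ n : ℕ) := by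
  have h2 : ∀ᶠ n : ℕ in atTop, fracRate u v k₀ - ε < Real.log (fracProd u v k₀ n : ℕ) / n :=
    (tendsto_log_fracProd_div hu huv hv k₀).eventually (eventually_gt_nhds (by linarith))
  filter_upwards [h2, eventually_gt_atTop 0] with n hn hn0
  have hn' : (0 : ℝ) < n := by exact_mod_cast hn0
  have hpos : (0 : ℝ) < (fracProd u v k₀ n : ℕ) := by exact_mod_cast fracProd_pos u v k₀ n
  rw [lt_div_iff₀ hn'] at hn
  calc Real.exp ((fracRate u v k₀ - ε) * n) ≤ Real.exp (Real.log (fracProd u v k₀ n : ℕ)) :=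
        Real.exp_le_exp.mpr hn.le
    _ = (fracProd u v k₀ n : ℕ) := Real.exp_log hpos

/-- Upper bound: `fracProd u v k₀ n ≤ e^{(S + ε) n}` for all large `n`. [cite: Hata1992, §2 p. 341] -/
theorem eventually_fracProd_le_exp (hu : 0 < u) (huv : u < v) (hv : v ≤ 1) (k₀ : ℕ) {ε : ℝ} (hε : 0 < ε) :
    ∀ᶠ n : ℕ in atTop, ((fracProd u v k₀ n : ℕ) : ℝ) ≤ Real.exp ((fracRate u v k₀ + ε) * n) := by
  have h2 : ∀ᶠ n : ℕ in atTop, Real.log (fracProd u v k₀ n : ℕ) / n < fracRate u v k₀ + ε :=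
    (tendsto_log_fracProd_div hu huv hv k₀).eventually (eventually_lt_nhds (by linarith))
  filter_upwards [h2, eventually_gt_atTop 0] with n hn hn0
  have hn' : (0 : ℝ) < n := by exact_mod_cast hn0
  have hpos : (0 : ℝ) < (fracProd u v k₀ n : ℕ) := by exact_mod_cast fracProd_pos u v k₀ n
  rw [div_lt_iff₀ hn'] at hn
  calc ((fracProd u v k₀ n : ℕ) : ℝ) = Real.exp (Real.log (fracProd u v k₀ n : ℕ)) := (Real.exp_log hpos).symm
    _ ≤ Real.exp ((fracRate u v k₀ + ε) * n) := Real.exp_le_exp.mpr hn.le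

end Literature.NumberTheory.Irrationality.Hata1992
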